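import Literature.NumberTheory.NumberFields.CMFieldQuadraticLayerNoCapitulation
import HarnessLib

/-!
# The capitulation kernel of a quadratic CM layer `L/M` with ONE exceptional (ramified) prime: `ker(Cl(M) → Cl(L)) ⊆ ⟨[w₀]⟩·i(Cl M⁺)`, and
# the class of a prime `W₀` of `L` with `e(W₀∣w₀) = e(W₀∣W₀ ∩ L⁺) = 2` is NOT an extended class (Ferrero 1980 / Kida 1979 bookkeeping at a prime
# where capitulation does occur; proved)

Topic `NumberTheory/NumberFields` (namespace = path, sub-namespace `CMLayer`).  THEOREM-ONLY file (no definition, no named fact, no instance, no `sorry`),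
written by the prover seat `bsd-line-att-p3` g32 (cell `bsd-f1-sign2`; `--supports` stmt-BirchSwinnertonDyer-22298; closes nothing).  Sequel of
`CMFieldQuadraticLayerNoCapitulation.lean` (seat g31: `Cl(M) → Cl(L)` injective under (T), (NPI), (ODD), (RAM)), for the layers of the cyclotomic `ℤ₂`-tower of an
imaginary quadratic field in which `2` RAMIFIES (`d ≡ 1, 2 (mod 4)`): there hypothesis (RAM) fails at exactly one prime (the dyadic one), capitulation of order `2`
occurs, and the two theorems below are what survives.

SETTING.  `M ⊆ L` CM number fields, `[L : M] = 2`, `σ` the non-trivial `M`-automorphism, `c` complex conjugation; (T) the roots of unity of `L` are `σ`-fixed;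
(NPI) no unit `ε` of `L` has `ε̄ = −ε`; (ODD) `h(M⁺)` odd.

* §1 `smul_eq_of_ramificationIdx_eq_finrank` — a prime `W` of `L` with `e(W ∣ W ∩ M) = [L : M]` is the ONLY prime above `W ∩ M`, hence fixed by `Gal(L/M)`
  (fundamental identity `g·e·f = [L:M]`).
* §2 ★ `mk0_not_mem_range_classGroupExtend` — (T), (NPI), and a prime `W₀` of `L` with `e(W₀ ∣ W₀ ∩ M) = 2` and `e(W₀ ∣ W₀ ∩ L⁺) = 2`: **`[W₀] ∉ i_{L/M}(Cl(M))`.**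
  PROOF: `W₀ = (γ)·𝔞𝓞_L` (`γ ∈ L^×`) and `σW₀ = W₀` give `σγ = γε` with a unit `ε`, `ε σε = 1`; `ε` is real ((T), (NPI), g31's `complexConj_unit_eq_self`), Hilbert 90
  has a real integral solution `β` (`σβ = εβ`), `γ/β ∈ M`, so `W₀ = (β)·𝔟𝓞_L` with `𝔟` a fractional ideal of `M` and `β ∈ L⁺`; the exponent of `W₀` in the right-hand
  side is `e(W₀∣w₀)·ord_{w₀} 𝔟 + e(W₀∣W₀∩L⁺)·ord((β)_{L⁺}) ≡ 0 (mod 2)`, not `1`.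
* §3 ★ `eq_mk0_zpow_mul_of_classGroupExtend_eq_one` — (T), (NPI), (ODD), a prime `w₀` of `M` with `e(w₀ ∣ w₀ ∩ M⁺) = 2`, and (RAM′): for every prime `w ≠ w₀`
  of `M` ramified over `M⁺` and every `W ∣ w`, `e(W ∣ w) = 1` and `e(W ∣ W ∩ L⁺) = e(w ∣ w ∩ M⁺)`.  THEN every capitulating class is **`[𝔞] = [w₀]^k · i_{M/M⁺}(g)`**
  for some `k ∈ ℤ` and `g ∈ Cl(M⁺)` (g31's descent, run on `𝔟·w₀^{−ord_{w₀} 𝔟}`); ★ `eq_one_or_eq_mk0_of_classGroupExtend_eq_one` — if moreover `[w₀]² = 1`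
  then **`ker(Cl(M) → Cl(L)) ⊆ {1, [w₀]}`** (`i_{M/M⁺}(g)` has odd order and square `1`).

Not found in print in this finite form (Ferrero 1980 §3 / Kida 1979 treat `ℚ(√−d)`; Schettler 2014 Thm. 8 computes `|H¹(G,P_L)| = 1`, `|H²(G,P_L)| = 2` at infinite
level); ingredients cited at each use (D-0014: our proof assembled from cited ingredients).

References: [Ferrero1980AJM] §3; [Kida1979Tohoku] Thm. 1; [Schettler2014] Thm. 8 and Rem. 9; [Washington1997] Thm. 10.3, Prop. 13.26; [Lang1990] Ch. 13 §4 Lemma 4.1;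
[NeukirchANT1999] Ch. I §8 (8.2), §9 (9.1), Ch. III §1 (1.6).
-/

set_option autoImplicit false

noncomputable section

open NumberField NumberField.IsCMField NumberField.Units IsDedekindDomain FractionalIdeal
open scoped nonZeroDivisors Pointwise

namespace Literature.NumberTheory.NumberFields

open Literature.NumberTheory.NumberFields.AmbiguousClass Literature.NumberTheory.NumberFields.AmbiguousIdeal
  Literature.NumberTheory.Automorphic Literature.NumberTheory.GaloisRepresentations Literature.NumberTheory.GaloisRepresentations.Herbrand

namespace CMLayer

/-! ## §1 A prime with `e = [L : M]` is alone above its restriction, hence Galois-fixed -/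

section Unique

variable (M L : Type) [Field M] [NumberField M] [Field L] [NumberField L] [Algebra M L]

/-- **A prime `W` of `L` with `e(W ∣ W ∩ M) = [L : M]` (Galois) is fixed by every `σ ∈ Gal(L/M)`**: by the fundamental identity `g·e·f = [L : M]` there is exactly
one prime above `W ∩ M`, and `σW` is one. [cite: NeukirchANT1999, Ch. I §9 Prop. (9.1) and Cor. (9.4) (`∑ eᵢfᵢ = n`, transitivity)] -/
theorem smul_eq_of_ramificationIdx_eq_finrank [IsGalois M L] (σ : L ≃ₐ[M] L) (W : HeightOneSpectrum (𝓞 L))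
    (hW : W.asIdeal.ramificationIdx (𝓞 M) = Module.finrank M L) : σ • W = W := by
  haveI : IsGaloisGroup (L ≃ₐ[M] L) (𝓞 M) (𝓞 L) := IsGaloisGroup.of_isFractionRing _ _ _ M L
  haveI := W.isPrime
  set w := W.under (𝓞 M) with hw
  haveI : W.asIdeal.LiesOver w.asIdeal := ⟨rfl⟩
  haveI : (σ • W).asIdeal.IsPrime := (σ • W).isPrime
  haveI : (σ • W).asIdeal.LiesOver w.asIdeal :=
    ⟨congrArg HeightOneSpectrum.asIdeal (HeightOneSpectrum.under_smul (𝓞 M) σ W).symm⟩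
  have hcard : Nat.card (L ≃ₐ[M] L) = Module.finrank M L := IsGalois.card_aut_eq_finrank M L
  have h := Ideal.ncard_primesOver_mul_ramificationIdxIn_mul_inertiaDegIn w.asIdeal (𝓞 L) (L ≃ₐ[M] L)
  rw [hcard, Ideal.ramificationIdxIn_eq_ramificationIdx w.asIdeal W.asIdeal (L ≃ₐ[M] L), hW] at h
  have hpos : 0 < Module.finrank M L := Module.finrank_pos
  have h1 : (w.asIdeal.primesOver (𝓞 L)).ncard * w.asIdeal.inertiaDegIn (𝓞 L) = 1 := by
    apply Nat.eq_of_mul_eq_mul_right hpos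
    calc (w.asIdeal.primesOver (𝓞 L)).ncard * w.asIdeal.inertiaDegIn (𝓞 L) * Module.finrank M L
        = (w.asIdeal.primesOver (𝓞 L)).ncard * (Module.finrank M L * w.asIdeal.inertiaDegIn (𝓞 L)) := by ring
      _ = Module.finrank M L := h
      _ = 1 * Module.finrank M L := (one_mul _).symm
  have hncard : (w.asIdeal.primesOver (𝓞 L)).ncard = 1 := Nat.eq_one_of_mul_eq_one_right h1
  obtain ⟨P, hP⟩ := Set.ncard_eq_one.mp hncard
  have hWmem : W.asIdeal ∈ w.asIdeal.primesOver (𝓞 L) := ⟨W.isPrime, inferInstance⟩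
  have hσWmem : (σ • W).asIdeal ∈ w.asIdeal.primesOver (𝓞 L) := ⟨(σ • W).isPrime, inferInstance⟩
  rw [hP, Set.mem_singleton_iff] at hWmem hσWmem
  exact HeightOneSpectrum.ext (hσWmem.trans hWmem.symm)

end Unique

/-! ## §2 The class of the totally ramified prime is not an extended class -/

section NotExtended

variable (M L : Type) [Field M] [NumberField M] [Field L] [NumberField L] [Algebra M L] [IsCMField M] [IsCMField L]

/-- ★ **`[W₀] ∉ i_{L/M}(Cl(M))` for a prime `W₀` of `L` with `e(W₀ ∣ W₀ ∩ M) = 2 = [L : M]` and `e(W₀ ∣ W₀ ∩ L⁺) = 2`**, under (T) and (NPI) (module docstring §2: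
`W₀ = (γ)·𝔞𝓞_L`, `σγ = γε`, `ε` real, real Hilbert 90, `W₀ = (β)·𝔟𝓞_L` with `β ∈ L⁺`, and the exponent of `W₀` on the right is even).
[cite: Ferrero1980AJM, §3] [cite: Schettler2014, Thm. 8 (proof: `|H¹(G, 𝓞_L^×)| = 2`, generated by `−1`)] [cite: NeukirchANT1999, Ch. I §8 Prop. (8.2)] -/
theorem mk0_not_mem_range_classGroupExtend (h2 : Module.finrank M L = 2)
    (hT : ∀ (σ : L ≃ₐ[M] L) (x : L) (n : ℕ), 0 < n → x ^ n = 1 → σ x = x)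
    (hNPI : ∀ u : (𝓞 L)ˣ, complexConj L ((u : 𝓞 L) : L) ≠ -((u : 𝓞 L) : L))
    (W₀ : HeightOneSpectrum (𝓞 L)) (hW₀ : W₀.asIdeal.ramificationIdx (𝓞 M) = 2)
    (hW₀' : W₀.asIdeal.ramificationIdx (𝓞 ↥(maximalRealSubfield L)) = 2) :
    ClassGroup.mk0 ⟨W₀.asIdeal, mem_nonZeroDivisors_of_ne_zero W₀.ne_bot⟩ ∉ (classGroupExtend M L).range := by
  classical
  rintro ⟨c, hc⟩
  haveI : Module.Free M L := Module.Free.of_divisionRing M L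
  haveI : Algebra.IsQuadraticExtension M L := { finrank_eq_two' := h2 }
  haveI : IsGalois M L := Algebra.IsQuadraticExtension.isGalois M L
  obtain ⟨σ, hσ, hσσ⟩ := exists_algEquiv_ne_one M L h2
  have hfix : σ • W₀ = W₀ := smul_eq_of_ramificationIdx_eq_finrank M L σ W₀ (by rw [hW₀, h2])
  -- (1) `W₀ = (γ)·𝔞𝓞_L`
  obtain ⟨⟨𝔞, h𝔞⟩, rfl⟩ := ClassGroup.mk0_surjective c
  have h𝔞0 : 𝔞 ≠ ⊥ := nonZeroDivisors.ne_zero h𝔞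
  rw [classGroupExtend_mk0, ClassGroup.mk0_eq_mk0_iff_exists_fraction_ring L] at hc
  obtain ⟨γ, hγ0, hγ⟩ := hc
  set 𝔞L : Ideal (𝓞 L) := 𝔞.map (algebraMap (𝓞 M) (𝓞 L)) with h𝔞L
  have h𝔞L0 : 𝔞L ≠ ⊥ := (Ideal.map_eq_bot_iff_of_injective (FaithfulSMul.algebraMap_injective (𝓞 M) (𝓞 L))).not.mpr h𝔞0
  have h𝔞Lf0 : (𝔞L : FractionalIdeal (𝓞 L)⁰ L) ≠ 0 := coeIdeal_ne_zero.mpr h𝔞L0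
  have hγ' : spanSingleton (𝓞 L)⁰ γ * (𝔞L : FractionalIdeal (𝓞 L)⁰ L) = (W₀.asIdeal : FractionalIdeal (𝓞 L)⁰ L) := hγ
  -- (2) `σγ = γ ε`
  have hσ𝔞L : σ • 𝔞L = 𝔞L := by rw [smul_ideal_eq_map]; exact map_intAut_map_eq M L σ 𝔞
  have hσW₀ : σ • W₀.asIdeal = W₀.asIdeal := congrArg HeightOneSpectrum.asIdeal hfix
  have happly := congrArg (fracIdealAut σ) hγ'
  rw [map_mul, fracIdealAut_spanSingleton, fracIdealAut_coeIdeal, fracIdealAut_coeIdeal, hσ𝔞L, hσW₀, ← hγ'] at happly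
  have hspan : spanSingleton (𝓞 L)⁰ (σ γ) = spanSingleton (𝓞 L)⁰ γ := mul_right_cancel₀ h𝔞Lf0 happly
  obtain ⟨u, hu⟩ := FractionalIdeal.spanSingleton_eq_spanSingleton.mp hspan.symm
  -- `hu : u • γ = σ γ`
  set e : L := (((u : 𝓞 L)) : L) with he
  have heγ : σ γ = γ * e := by rw [← hu, Units.smul_def, Algebra.smul_def, mul_comm]
  have hue : ((u : 𝓞 L) : L) = e := rfl
  have hun : e * σ e = 1 := unit_mul_algEquiv_unit_eq_one M L hσσ hγ0 heγ
  have hreal : complexConj L e = e := complexConj_unit_eq_self M L σ (hT σ) hNPI u hun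
  obtain ⟨β, hβ0, hβreal, hβσ⟩ := exists_real_integer_algEquiv_eq_mul M L hσ hσσ u hun hreal
  obtain ⟨m₁, m₂, hm₂0, hγβ⟩ := exists_integers_mul_eq_mul M L h2 hσ hβ0 heγ hβσ
  -- `hγβ : γ * algebraMap M L m₂ = algebraMap M L m₁ * β`
  obtain ⟨b, hb⟩ := (IsCMField.RingOfIntegers.complexConj_eq_self_iff L β).mp hβreal
  have hbβ : algebraMap (𝓞 ↥(maximalRealSubfield L)) (𝓞 L) b = β := RingOfIntegers.ext (by
    rw [← hb]; exact (IsScalarTower.algebraMap_apply (𝓞 ↥(maximalRealSubfield L)) (𝓞 L) L b).symm)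
  have hb0 : (Ideal.span {b} : Ideal (𝓞 ↥(maximalRealSubfield L))) ≠ ⊥ := by
    rw [Ne, Ideal.span_singleton_eq_bot]
    rintro rfl
    rw [map_zero] at hb
    exact hβ0 hb.symm
  have hm₁0 : (m₁ : M) ≠ 0 := by
    intro h0
    rw [h0, map_zero, zero_mul] at hγβ
    exact (mul_ne_zero hγ0 ((_root_.map_ne_zero _).mpr hm₂0)) hγβ
  have hm₁I : (Ideal.span {m₁} : Ideal (𝓞 M)) ≠ ⊥ := by
    rw [Ne, Ideal.span_singleton_eq_bot]; rintro rfl; exact hm₁0 rfl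
  have hm₂I : (Ideal.span {m₂} : Ideal (𝓞 M)) ≠ ⊥ := by
    rw [Ne, Ideal.span_singleton_eq_bot]; rintro rfl; exact hm₂0 rfl
  have hβI : (Ideal.span {β} : Ideal (𝓞 L)) ≠ ⊥ := by
    rw [Ne, Ideal.span_singleton_eq_bot]; rintro rfl; exact hβ0 rfl
  -- (3) `W₀ = (β) · (𝔞 (m₁) (m₂)⁻¹)𝓞_L` as fractional ideals
  set A : (FractionalIdeal (𝓞 M)⁰ M)ˣ := FractionalIdeal.mk0 M ⟨𝔞, h𝔞⟩ with hA
  set P₁ : (FractionalIdeal (𝓞 M)⁰ M)ˣ := FractionalIdeal.mk0 M ⟨Ideal.span {m₁}, mem_nonZeroDivisors_of_ne_zero hm₁I⟩ with hP₁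
  set P₂ : (FractionalIdeal (𝓞 M)⁰ M)ˣ := FractionalIdeal.mk0 M ⟨Ideal.span {m₂}, mem_nonZeroDivisors_of_ne_zero hm₂I⟩ with hP₂
  set 𝔟 : (FractionalIdeal (𝓞 M)⁰ M)ˣ := A * P₁ * P₂⁻¹ with h𝔟
  set B : (FractionalIdeal (𝓞 L)⁰ L)ˣ := FractionalIdeal.mk0 L ⟨Ideal.span {β}, mem_nonZeroDivisors_of_ne_zero hβI⟩ with hB
  set ι := (Units.map (extendedHom L (𝓞 L) : FractionalIdeal (𝓞 M)⁰ M →+* FractionalIdeal (𝓞 L)⁰ L).toMonoidHom) with hι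
  have hιval : ∀ (J : Ideal (𝓞 M)) (hJ : J ≠ ⊥),
      ((ι (FractionalIdeal.mk0 M ⟨J, mem_nonZeroDivisors_of_ne_zero hJ⟩) : (FractionalIdeal (𝓞 L)⁰ L)ˣ) : FractionalIdeal (𝓞 L)⁰ L) =
        ((J.map (algebraMap (𝓞 M) (𝓞 L)) : Ideal (𝓞 L)) : FractionalIdeal (𝓞 L)⁰ L) := fun J hJ => by
    rw [hι, Units.coe_map, RingHom.toMonoidHom_eq_coe, MonoidHom.coe_coe, FractionalIdeal.coe_mk0]
    exact extendedHom_coeIdeal_eq_map L (𝓞 L) J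
  have hW₀U : (W₀.asIdeal : FractionalIdeal (𝓞 L)⁰ L) = ((B * ι 𝔟 : (FractionalIdeal (𝓞 L)⁰ L)ˣ) : FractionalIdeal (𝓞 L)⁰ L) := by
    have hBval : ((B : (FractionalIdeal (𝓞 L)⁰ L)ˣ) : FractionalIdeal (𝓞 L)⁰ L) = spanSingleton (𝓞 L)⁰ (β : L) := by
      rw [hB, FractionalIdeal.coe_mk0]; exact coeIdeal_span_singleton β
    have hAval : ((ι A : (FractionalIdeal (𝓞 L)⁰ L)ˣ) : FractionalIdeal (𝓞 L)⁰ L) = (𝔞L : FractionalIdeal (𝓞 L)⁰ L) := by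
      rw [hA]
      have := hιval 𝔞 h𝔞0
      convert this using 3
    rw [Units.val_mul, hBval, h𝔟, map_mul, map_mul, map_inv, Units.val_mul, Units.val_mul, Units.val_inv_eq_inv_val, hAval, hιval _ hm₁I, hιval _ hm₂I,
      Ideal.map_span, Set.image_singleton, Ideal.map_span, Set.image_singleton, coeIdeal_span_singleton, coeIdeal_span_singleton, ← hγ']
    have hm₂L : algebraMap M L (m₂ : M) ≠ 0 := (_root_.map_ne_zero _).mpr hm₂0
    have hγeq : γ = (β : L) * algebraMap M L (m₁ : M) * (algebraMap M L (m₂ : M))⁻¹ := by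
      rw [eq_mul_inv_iff_mul_eq₀ hm₂L, hγβ, mul_comm]
    have e1 : (algebraMap (𝓞 L) L) ((algebraMap (𝓞 M) (𝓞 L)) m₁) = algebraMap M L (m₁ : M) := rfl
    have e2 : (algebraMap (𝓞 L) L) ((algebraMap (𝓞 M) (𝓞 L)) m₂) = algebraMap M L (m₂ : M) := rfl
    rw [e1, e2, spanSingleton_inv,
      show spanSingleton (𝓞 L)⁰ (β : L) * ((𝔞L : FractionalIdeal (𝓞 L)⁰ L) * spanSingleton (𝓞 L)⁰ (algebraMap M L (m₁ : M)) *
          spanSingleton (𝓞 L)⁰ (algebraMap M L (m₂ : M))⁻¹) =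
        spanSingleton (𝓞 L)⁰ (β : L) * spanSingleton (𝓞 L)⁰ (algebraMap M L (m₁ : M)) * spanSingleton (𝓞 L)⁰ (algebraMap M L (m₂ : M))⁻¹ *
          (𝔞L : FractionalIdeal (𝓞 L)⁰ L) by ring,
      spanSingleton_mul_spanSingleton, spanSingleton_mul_spanSingleton, hγeq]
  -- (4) exponents at `W₀`: `1 = e(W₀∣W₀∩L⁺)·ord((b)) + e(W₀∣w₀)·ord_{w₀} 𝔟 = 2·(…)`
  have hcountB : count L W₀ ((B : (FractionalIdeal (𝓞 L)⁰ L)ˣ) : FractionalIdeal (𝓞 L)⁰ L) =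
      2 * count ↥(maximalRealSubfield L) (W₀.under (𝓞 ↥(maximalRealSubfield L)))
        ((Ideal.span {b} : Ideal (𝓞 ↥(maximalRealSubfield L))) : FractionalIdeal (𝓞 ↥(maximalRealSubfield L))⁰ ↥(maximalRealSubfield L)) := by
    have h := count_coeIdeal_map ↥(maximalRealSubfield L) L W₀ (J := Ideal.span {b}) hb0
    rw [Ideal.map_span, Set.image_singleton, hbβ, hW₀'] at h
    rw [hB, FractionalIdeal.coe_mk0]
    exact_mod_cast h
  have hcountι : count L W₀ ((ι 𝔟 : (FractionalIdeal (𝓞 L)⁰ L)ˣ) : FractionalIdeal (𝓞 L)⁰ L) = 2 * count M (W₀.under (𝓞 M)) (𝔟 : FractionalIdeal (𝓞 M)⁰ M) := by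
    have h := count_extendedHom M L W₀ 𝔟
    rw [hW₀] at h
    rw [hι, Units.coe_map, RingHom.toMonoidHom_eq_coe, MonoidHom.coe_coe]
    exact_mod_cast h
  have hone : count L W₀ (W₀.asIdeal : FractionalIdeal (𝓞 L)⁰ L) = 1 := count_self L W₀
  rw [hW₀U, count_units_mul, hcountB, hcountι] at hone
  omega

end NotExtended

/-! ## §3 The capitulation kernel: `ker(Cl(M) → Cl(L)) ⊆ ⟨[w₀]⟩ · i(Cl M⁺)` -/

section Kernel

variable (M L : Type) [Field M] [NumberField M] [Field L] [NumberField L] [Algebra M L] [IsCMField M] [IsCMField L]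

/-- ★ **The capitulation kernel with one exceptional prime.**  `M ⊆ L` CM, `[L : M] = 2`, (T), (NPI); `w₀` a prime of `M` with `e(w₀ ∣ w₀ ∩ M⁺) = 2`; (RAM′): for
every prime `w ≠ w₀` of `M` ramified over `M⁺` and every `W ∣ w`, `e(W ∣ w) = 1` and `e(W ∣ W ∩ L⁺) = e(w ∣ w ∩ M⁺)`.  THEN a class `c` with `i_{L/M}(c) = 1` is
**`c = [w₀]^k · i_{M/M⁺}(g)`** for some `k ∈ ℤ`, `g ∈ Cl(M⁺)`.  (g31's proof of `classGroupExtend_injective_of_cmLayer`: `𝔞𝓞_L = (α)`, `σα = εα`, `ε` real, real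
Hilbert 90, `𝔟 = 𝔞(m₂)(m₁)⁻¹` with `𝔟𝓞_L = (β)`, `β ∈ L⁺`, conjugation-invariant exponents; here the exponents of `𝔟' = 𝔟·w₀^{−ord_{w₀}𝔟}` are divisible by the
`e(w ∣ w ∩ M⁺)`, so `𝔟' = 𝔟₀𝓞_M` — Lang XIII §4 Lemma 4.1.) [cite: Ferrero1980AJM, §3] [cite: Kida1979Tohoku, Thm. 1 (proof)] [cite: Washington1997, Thm. 10.3 and Prop. 13.26]
[cite: Lang1990, Ch. 13 §4 Lemma 4.1] -/
theorem eq_mk0_zpow_mul_of_classGroupExtend_eq_one (h2 : Module.finrank M L = 2)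
    (hT : ∀ (σ : L ≃ₐ[M] L) (x : L) (n : ℕ), 0 < n → x ^ n = 1 → σ x = x)
    (hNPI : ∀ u : (𝓞 L)ˣ, complexConj L ((u : 𝓞 L) : L) ≠ -((u : 𝓞 L) : L))
    (w₀ : HeightOneSpectrum (𝓞 M)) (hw₀ : w₀.asIdeal.ramificationIdx (𝓞 ↥(maximalRealSubfield M)) = 2)
    (hram : ∀ w : HeightOneSpectrum (𝓞 M), w ≠ w₀ → w.asIdeal.ramificationIdx (𝓞 ↥(maximalRealSubfield M)) ≠ 1 →
      ∀ W : HeightOneSpectrum (𝓞 L), W.under (𝓞 M) = w →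
        W.asIdeal.ramificationIdx (𝓞 M) = 1 ∧
          W.asIdeal.ramificationIdx (𝓞 ↥(maximalRealSubfield L)) = w.asIdeal.ramificationIdx (𝓞 ↥(maximalRealSubfield M)))
    {c : ClassGroup (𝓞 M)} (hc : classGroupExtend M L c = 1) :
    ∃ (k : ℤ) (g : ClassGroup (𝓞 ↥(maximalRealSubfield M))),
      c = ClassGroup.mk0 ⟨w₀.asIdeal, mem_nonZeroDivisors_of_ne_zero w₀.ne_bot⟩ ^ k * classGroupExtend ↥(maximalRealSubfield M) M g := by
  classical
  obtain ⟨σ, hσ, hσσ⟩ := exists_algEquiv_ne_one M L h2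
  -- `w₀` is fixed by complex conjugation (it is alone above `w₀ ∩ M⁺`)
  have hw₀c : (complexConj M) • w₀ = w₀ :=
    smul_eq_of_ramificationIdx_eq_finrank ↥(maximalRealSubfield M) M (complexConj M) w₀
      (by rw [hw₀, (IsCMField.isQuadraticExtension M).finrank_eq_two])
  -- (1) generator, unit, reality, Hilbert 90, descent
  obtain ⟨𝔞, h𝔞, α, rfl, hα, hα0⟩ := exists_rep_of_classGroupExtend_eq_one M L hc
  obtain ⟨u, hu⟩ := exists_unit_algEquiv_eq_mul M L σ hα
  have hα0' : (α : L) ≠ 0 := by exact_mod_cast hα0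
  have hun : ((u : 𝓞 L) : L) * σ ((u : 𝓞 L) : L) = 1 := unit_mul_algEquiv_unit_eq_one M L hσσ hα0' hu
  have hreal := complexConj_unit_eq_self M L σ (hT σ) hNPI u hun
  obtain ⟨β, hβ0, hβreal, hβσ⟩ := exists_real_integer_algEquiv_eq_mul M L hσ hσσ u hun hreal
  obtain ⟨m₁, m₂, hm₂0, hαβ⟩ := exists_integers_mul_eq_mul M L h2 hσ hβ0 hu hβσ
  obtain ⟨b, hb⟩ := (IsCMField.RingOfIntegers.complexConj_eq_self_iff L β).mp hβreal
  have hbβ : algebraMap (𝓞 ↥(maximalRealSubfield L)) (𝓞 L) b = β := RingOfIntegers.ext (by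
    rw [← hb]; exact (IsScalarTower.algebraMap_apply (𝓞 ↥(maximalRealSubfield L)) (𝓞 L) L b).symm)
  have hb0 : (Ideal.span {b} : Ideal (𝓞 ↥(maximalRealSubfield L))) ≠ ⊥ := by
    rw [Ne, Ideal.span_singleton_eq_bot]
    rintro rfl
    rw [map_zero] at hb
    exact hβ0 hb.symm
  have hm₁0 : (m₁ : M) ≠ 0 := by
    intro h0
    rw [h0, map_zero, zero_mul] at hαβ
    exact (mul_ne_zero hα0' ((_root_.map_ne_zero _).mpr hm₂0)) hαβ
  have hm₁I : (Ideal.span {m₁} : Ideal (𝓞 M)) ≠ ⊥ := by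
    rw [Ne, Ideal.span_singleton_eq_bot]; rintro rfl; exact hm₁0 rfl
  have hm₂I : (Ideal.span {m₂} : Ideal (𝓞 M)) ≠ ⊥ := by
    rw [Ne, Ideal.span_singleton_eq_bot]; rintro rfl; exact hm₂0 rfl
  have hβI : (Ideal.span {β} : Ideal (𝓞 L)) ≠ ⊥ := by
    rw [Ne, Ideal.span_singleton_eq_bot]; rintro rfl; exact hβ0 rfl
  -- (2) the fractional ideal `𝔟 = 𝔞 (m₂) (m₁)⁻¹` of `M` and `(β)` of `L`
  set A : (FractionalIdeal (𝓞 M)⁰ M)ˣ := FractionalIdeal.mk0 M ⟨𝔞, mem_nonZeroDivisors_of_ne_zero h𝔞⟩ with hA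
  set P₁ : (FractionalIdeal (𝓞 M)⁰ M)ˣ := FractionalIdeal.mk0 M ⟨Ideal.span {m₁}, mem_nonZeroDivisors_of_ne_zero hm₁I⟩ with hP₁
  set P₂ : (FractionalIdeal (𝓞 M)⁰ M)ˣ := FractionalIdeal.mk0 M ⟨Ideal.span {m₂}, mem_nonZeroDivisors_of_ne_zero hm₂I⟩ with hP₂
  set 𝔟 : (FractionalIdeal (𝓞 M)⁰ M)ˣ := A * P₂ * P₁⁻¹ with h𝔟
  set B : (FractionalIdeal (𝓞 L)⁰ L)ˣ := FractionalIdeal.mk0 L ⟨Ideal.span {β}, mem_nonZeroDivisors_of_ne_zero hβI⟩ with hB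
  set ι := (Units.map (extendedHom L (𝓞 L) : FractionalIdeal (𝓞 M)⁰ M →+* FractionalIdeal (𝓞 L)⁰ L).toMonoidHom) with hι
  have hιval : ∀ (J : Ideal (𝓞 M)) (hJ : J ≠ ⊥),
      ((ι (FractionalIdeal.mk0 M ⟨J, mem_nonZeroDivisors_of_ne_zero hJ⟩) : (FractionalIdeal (𝓞 L)⁰ L)ˣ) : FractionalIdeal (𝓞 L)⁰ L) =
        ((J.map (algebraMap (𝓞 M) (𝓞 L)) : Ideal (𝓞 L)) : FractionalIdeal (𝓞 L)⁰ L) := fun J hJ => by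
    rw [hι, Units.coe_map, RingHom.toMonoidHom_eq_coe, MonoidHom.coe_coe, FractionalIdeal.coe_mk0]
    exact extendedHom_coeIdeal_eq_map L (𝓞 L) J
  have hext : ι 𝔟 = B := by
    apply Units.ext
    have hBval : ((B : (FractionalIdeal (𝓞 L)⁰ L)ˣ) : FractionalIdeal (𝓞 L)⁰ L) = spanSingleton (𝓞 L)⁰ (β : L) := by
      rw [hB, FractionalIdeal.coe_mk0]; exact coeIdeal_span_singleton β
    rw [hBval, h𝔟, map_mul, map_mul, map_inv, Units.val_mul, Units.val_mul, Units.val_inv_eq_inv_val, hιval 𝔞 h𝔞, hιval _ hm₁I, hιval _ hm₂I, hα,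
      Ideal.map_span, Set.image_singleton, Ideal.map_span, Set.image_singleton, coeIdeal_span_singleton, coeIdeal_span_singleton, coeIdeal_span_singleton,
      spanSingleton_mul_spanSingleton, spanSingleton_inv, spanSingleton_mul_spanSingleton]
    congr 1
    have hm₁L : algebraMap M L (m₁ : M) ≠ 0 := (_root_.map_ne_zero _).mpr hm₁0
    change (α : L) * algebraMap M L (m₂ : M) * (algebraMap M L (m₁ : M))⁻¹ = (β : L)
    rw [hαβ]; field_simp
  -- (3) exponents: `e(W∣w)·ord_w 𝔟 = e(W∣W∩L⁺)·ord((b))` for every prime `W` of `L`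
  have hcount : ∀ W : HeightOneSpectrum (𝓞 L),
      (W.asIdeal.ramificationIdx (𝓞 M) : ℤ) * count M (W.under (𝓞 M)) (𝔟 : FractionalIdeal (𝓞 M)⁰ M) =
        (W.asIdeal.ramificationIdx (𝓞 ↥(maximalRealSubfield L)) : ℤ) *
          count ↥(maximalRealSubfield L) (W.under (𝓞 ↥(maximalRealSubfield L)))
            ((Ideal.span {b} : Ideal (𝓞 ↥(maximalRealSubfield L))) : FractionalIdeal (𝓞 ↥(maximalRealSubfield L))⁰ ↥(maximalRealSubfield L)) := by
    intro W
    have h1 := count_extendedHom M L W 𝔟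
    have h2 := count_coeIdeal_map ↥(maximalRealSubfield L) L W (J := Ideal.span {b}) hb0
    rw [Ideal.map_span, Set.image_singleton, hbβ] at h2
    have h3 : extendedHom L (𝓞 L) (𝔟 : FractionalIdeal (𝓞 M)⁰ M) = ((Ideal.span {β} : Ideal (𝓞 L)) : FractionalIdeal (𝓞 L)⁰ L) := by
      have := congrArg (fun I : (FractionalIdeal (𝓞 L)⁰ L)ˣ => (I : FractionalIdeal (𝓞 L)⁰ L)) hext
      simpa [hι, hB] using this
    rw [h3, h2] at h1
    exact h1.symm
  -- (4) `𝔟` has conjugation-invariant exponents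
  have hBinv : (complexConj L) • B = B := by
    apply Units.ext
    rw [coe_smul_fracIdeal, hB, FractionalIdeal.coe_mk0]
    change fracIdealAut (complexConj L) (((Ideal.span {β} : Ideal (𝓞 L))) : FractionalIdeal (𝓞 L)⁰ L) = _
    rw [coeIdeal_span_singleton, fracIdealAut_spanSingleton]
    change spanSingleton (𝓞 L)⁰ (complexConj L (β : L)) = _
    rw [hβreal]
  have hinv : ∀ w : HeightOneSpectrum (𝓞 M), count M ((complexConj M) • w) (𝔟 : FractionalIdeal (𝓞 M)⁰ M) = count M w (𝔟 : FractionalIdeal (𝓞 M)⁰ M) := by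
    intro w
    obtain ⟨W, hW⟩ := exists_under_eq M L w
    have hW' : ((complexConj L) • W).under (𝓞 M) = (complexConj M) • w := by rw [under_complexConj_smul M L W, hW]
    have h1 := hcount W
    have h2 := hcount ((complexConj L) • W)
    rw [hW] at h1
    rw [hW', ramificationIdx_complexConj_smul M L W] at h2
    have hB1 : count L ((complexConj L) • W) (B : FractionalIdeal (𝓞 L)⁰ L) = count L W (B : FractionalIdeal (𝓞 L)⁰ L) := by
      conv_lhs => rw [← hBinv]
      exact count_smul (complexConj L) W B
    have hR : ∀ V : HeightOneSpectrum (𝓞 L), (V.asIdeal.ramificationIdx (𝓞 ↥(maximalRealSubfield L)) : ℤ) *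
        count ↥(maximalRealSubfield L) (V.under (𝓞 ↥(maximalRealSubfield L)))
          ((Ideal.span {b} : Ideal (𝓞 ↥(maximalRealSubfield L))) : FractionalIdeal (𝓞 ↥(maximalRealSubfield L))⁰ ↥(maximalRealSubfield L)) =
        count L V (B : FractionalIdeal (𝓞 L)⁰ L) := by
      intro V
      have h := count_coeIdeal_map ↥(maximalRealSubfield L) L V (J := Ideal.span {b}) hb0
      rw [Ideal.map_span, Set.image_singleton, hbβ] at h
      rw [hB, FractionalIdeal.coe_mk0]
      exact h.symm
    rw [hR] at h1 h2
    rw [hB1, ← h1] at h2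
    have he0 : (W.asIdeal.ramificationIdx (𝓞 M) : ℤ) ≠ 0 := by
      have : W.asIdeal.ramificationIdx (𝓞 M) ≠ 0 := by
        haveI := W.isPrime
        exact (Ideal.ramificationIdx_pos W.asIdeal (𝓞 M)).ne'
      exact_mod_cast this
    exact mul_left_cancel₀ he0 h2
  -- (5) the corrected ideal `𝔟' = 𝔟 · w₀^{-k}`, `k = ord_{w₀} 𝔟`: conjugation-invariant exponents, all divisible by the `e(w ∣ w ∩ M⁺)`
  set W0 : (FractionalIdeal (𝓞 M)⁰ M)ˣ := FractionalIdeal.mk0 M ⟨w₀.asIdeal, mem_nonZeroDivisors_of_ne_zero w₀.ne_bot⟩ with hW0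
  set k : ℤ := count M w₀ (𝔟 : FractionalIdeal (𝓞 M)⁰ M) with hk
  set 𝔟' : (FractionalIdeal (𝓞 M)⁰ M)ˣ := 𝔟 * W0 ^ (-k) with h𝔟'
  have hW0val : ((W0 : (FractionalIdeal (𝓞 M)⁰ M)ˣ) : FractionalIdeal (𝓞 M)⁰ M) = (w₀.asIdeal : FractionalIdeal (𝓞 M)⁰ M) := by
    rw [hW0, FractionalIdeal.coe_mk0]
  have hcountW0 : ∀ w : HeightOneSpectrum (𝓞 M), count M w ((W0 : (FractionalIdeal (𝓞 M)⁰ M)ˣ) : FractionalIdeal (𝓞 M)⁰ M) = if w = w₀ then 1 else 0 := by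
    intro w
    rw [hW0val]
    split_ifs with h
    · rw [h]; exact count_self M w₀
    · exact count_maximal_coprime M w (Ne.symm h)
  have hcount' : ∀ w : HeightOneSpectrum (𝓞 M), count M w (𝔟' : FractionalIdeal (𝓞 M)⁰ M) =
      count M w (𝔟 : FractionalIdeal (𝓞 M)⁰ M) - (if w = w₀ then k else 0) := by
    intro w
    rw [h𝔟', count_units_mul, count_units_zpow, hcountW0]
    split_ifs <;> ring
  have hinv' : ∀ w : HeightOneSpectrum (𝓞 M), count M ((complexConj M) • w) (𝔟' : FractionalIdeal (𝓞 M)⁰ M) = count M w (𝔟' : FractionalIdeal (𝓞 M)⁰ M) := by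
    intro w
    rw [hcount', hcount', hinv]
    by_cases h : w = w₀
    · subst h; simp only [hw₀c, if_true]
    · have h' : (complexConj M) • w ≠ w₀ := by
        intro h''; apply h
        have := congrArg ((complexConj M)⁻¹ • ·) h''
        simp only [inv_smul_smul] at this
        rw [this]
        have hcc : (complexConj M)⁻¹ = complexConj M := by
          rw [inv_eq_iff_mul_eq_one]; ext x; exact complexConj_apply_apply M x
        rw [hcc, hw₀c]
      rw [if_neg h', if_neg h]
  have h𝔟fix : (complexConj M) • 𝔟' = 𝔟' := by
    refine units_ext_count M fun w => ?_
    rw [count_smul' (complexConj M) w 𝔟']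
    have hcc : (complexConj M)⁻¹ = complexConj M := by
      rw [inv_eq_iff_mul_eq_one]; ext x; exact complexConj_apply_apply M x
    rw [hcc, hinv']
  have h𝔟Z : 𝔟' ∈ z0 (complexConj M) (⊤ : Subgroup (FractionalIdeal (𝓞 M)⁰ M)ˣ) ⊥ := mem_z0_bot.mpr ⟨Subgroup.mem_top _, h𝔟fix⟩
  have hgen : ∀ τ : M ≃ₐ[↥(maximalRealSubfield M)] M, τ ∈ Subgroup.zpowers (complexConj M) := fun τ => by
    rw [zpowers_complexConj_eq_top]; exact Subgroup.mem_top τ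
  have hdvd : ∀ w : HeightOneSpectrum (𝓞 M),
      ((w.asIdeal.ramificationIdx (𝓞 ↥(maximalRealSubfield M)) : ℕ) : ℤ) ∣ count M w (𝔟' : FractionalIdeal (𝓞 M)⁰ M) := by
    intro w
    by_cases hw0 : w = w₀
    · subst hw0
      rw [hcount', if_pos rfl, hk, sub_self]
      exact dvd_zero _
    by_cases he : w.asIdeal.ramificationIdx (𝓞 ↥(maximalRealSubfield M)) = 1
    · rw [he, Nat.cast_one]; exact one_dvd _
    · obtain ⟨W, hW⟩ := exists_under_eq M L w
      obtain ⟨heW, heW'⟩ := hram w hw0 he W hW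
      have h := hcount W
      rw [hW, heW, Nat.cast_one, one_mul, heW'] at h
      rw [hcount', if_neg hw0, sub_zero]
      exact Dvd.intro _ h.symm
  -- (6) `𝔟' = 𝔟₀ 𝓞_M` for a fractional ideal `𝔟₀` of `M⁺`
  choose s hs using exists_under_eq ↥(maximalRealSubfield M) M
  have hsinj : Function.Injective s := fun a b h => by rw [← hs a, ← hs b, h]
  obtain ⟨𝔟₀, h𝔟₀⟩ := exists_units_count_eq ↥(maximalRealSubfield M)
    (fun v => count M (s v) (𝔟' : FractionalIdeal (𝓞 M)⁰ M) / (((s v).asIdeal.ramificationIdx (𝓞 ↥(maximalRealSubfield M)) : ℕ) : ℤ)) (by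
      rw [Filter.eventually_cofinite]
      refine ((finite_setOf_count_ne_zero M 𝔟').preimage hsinj.injOn).subset fun v hv => ?_
      intro h0
      apply hv
      show count M (s v) (𝔟' : FractionalIdeal (𝓞 M)⁰ M) / (((s v).asIdeal.ramificationIdx (𝓞 ↥(maximalRealSubfield M)) : ℕ) : ℤ) = 0
      rw [h0, Int.zero_ediv])
  have h𝔟eq : Units.map (extendedHom M (𝓞 M) : FractionalIdeal (𝓞 ↥(maximalRealSubfield M))⁰ ↥(maximalRealSubfield M) →+* FractionalIdeal (𝓞 M)⁰ M).toMonoidHom 𝔟₀ = 𝔟' := by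
    refine units_ext_count M fun w => ?_
    rw [Units.coe_map, RingHom.toMonoidHom_eq_coe, MonoidHom.coe_coe, count_extendedHom ↥(maximalRealSubfield M) M w 𝔟₀, h𝔟₀,
      count_eq_of_under_eq hgen h𝔟Z (hs (w.under (𝓞 ↥(maximalRealSubfield M)))),
      ramificationIdx_eq_ramificationIdxIn ↥(maximalRealSubfield M) M (s (w.under (𝓞 ↥(maximalRealSubfield M)))), hs,
      ← ramificationIdx_eq_ramificationIdxIn ↥(maximalRealSubfield M) M w]
    exact Int.mul_ediv_cancel' (hdvd w)
  -- (7) classes: `[𝔞] = [𝔟] = [𝔟'] · [w₀]^k = i_{M/M⁺}[𝔟₀] · [w₀]^k`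
  have hcl : ClassGroup.mk0 ⟨𝔞, mem_nonZeroDivisors_of_ne_zero h𝔞⟩ = ClassGroup.mk M 𝔟 := by
    rw [h𝔟, map_mul, map_mul, map_inv, ← ClassGroup.mk_mk0 M, ← hA]
    have h1 : ClassGroup.mk M P₁ = 1 := by rw [hP₁, ClassGroup.mk_mk0, ClassGroup.mk0_eq_one_iff]; exact ⟨⟨m₁, rfl⟩⟩
    have h2' : ClassGroup.mk M P₂ = 1 := by rw [hP₂, ClassGroup.mk_mk0, ClassGroup.mk0_eq_one_iff]; exact ⟨⟨m₂, rfl⟩⟩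
    rw [h1, h2', inv_one, mul_one, mul_one]
  have h𝔟𝔟' : ClassGroup.mk M 𝔟 = ClassGroup.mk M 𝔟' * ClassGroup.mk0 ⟨w₀.asIdeal, mem_nonZeroDivisors_of_ne_zero w₀.ne_bot⟩ ^ k := by
    rw [h𝔟', map_mul (ClassGroup.mk M) 𝔟 (W0 ^ (-k)), map_zpow (ClassGroup.mk M) W0 (-k), hW0, ClassGroup.mk_mk0, mul_assoc, ← zpow_add,
      neg_add_cancel, zpow_zero, mul_one]
  refine ⟨k, ClassGroup.mk ↥(maximalRealSubfield M) 𝔟₀, ?_⟩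
  rw [hcl, h𝔟𝔟', classGroupExtend_mk, h𝔟eq, mul_comm]

/-- ★ **`ker(Cl(M) → Cl(L)) ⊆ {1, [w₀]}` when moreover `[w₀]² = 1`.**  Under the hypotheses of `eq_mk0_zpow_mul_of_classGroupExtend_eq_one`, a capitulating class is
`c = [w₀]^k · i(g)`; `c² = 1` (`N ∘ i = 2`) and `[w₀]² = 1` force `i(g)² = 1`, and `i(g)` has ODD order (it divides `h(M⁺)`), so `i(g) = 1` and `c ∈ {1, [w₀]}`.
[cite: Ferrero1980AJM, §3] [cite: Kida1979Tohoku, Thm. 1 (proof)] [cite: Washington1997, Prop. 13.26 (the order-`2` capitulation at `p = 2`)] -/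
theorem eq_one_or_eq_mk0_of_classGroupExtend_eq_one (h2 : Module.finrank M L = 2)
    (hodd : Odd (classNumber ↥(maximalRealSubfield M)))
    (hT : ∀ (σ : L ≃ₐ[M] L) (x : L) (n : ℕ), 0 < n → x ^ n = 1 → σ x = x)
    (hNPI : ∀ u : (𝓞 L)ˣ, complexConj L ((u : 𝓞 L) : L) ≠ -((u : 𝓞 L) : L))
    (w₀ : HeightOneSpectrum (𝓞 M)) (hw₀ : w₀.asIdeal.ramificationIdx (𝓞 ↥(maximalRealSubfield M)) = 2)
    (hw₀sq : ClassGroup.mk0 ⟨w₀.asIdeal, mem_nonZeroDivisors_of_ne_zero w₀.ne_bot⟩ ^ 2 = 1)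
    (hram : ∀ w : HeightOneSpectrum (𝓞 M), w ≠ w₀ → w.asIdeal.ramificationIdx (𝓞 ↥(maximalRealSubfield M)) ≠ 1 →
      ∀ W : HeightOneSpectrum (𝓞 L), W.under (𝓞 M) = w →
        W.asIdeal.ramificationIdx (𝓞 M) = 1 ∧
          W.asIdeal.ramificationIdx (𝓞 ↥(maximalRealSubfield L)) = w.asIdeal.ramificationIdx (𝓞 ↥(maximalRealSubfield M)))
    {c : ClassGroup (𝓞 M)} (hc : classGroupExtend M L c = 1) :
    c = 1 ∨ c = ClassGroup.mk0 ⟨w₀.asIdeal, mem_nonZeroDivisors_of_ne_zero w₀.ne_bot⟩ := by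
  classical
  set x := ClassGroup.mk0 (⟨w₀.asIdeal, mem_nonZeroDivisors_of_ne_zero w₀.ne_bot⟩ : (Ideal (𝓞 M))⁰) with hx
  have hsq : c ^ 2 = 1 := by rw [← h2]; exact pow_finrank_eq_one_of_classGroupExtend_eq_one M L hc
  obtain ⟨k, g, hcg⟩ := eq_mk0_zpow_mul_of_classGroupExtend_eq_one M L h2 hT hNPI w₀ hw₀ hram hc
  set y := classGroupExtend ↥(maximalRealSubfield M) M g with hy
  -- `y` has odd order
  have hyodd : Odd (orderOf y) := by
    have h1 := orderOf_map_dvd (classGroupExtend ↥(maximalRealSubfield M) M) g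
    have h2' := orderOf_dvd_card (x := g)
    rw [← classNumber] at h2'
    exact Odd.of_dvd_nat hodd (h1.trans h2')
  -- `x^k ∈ {1, x}`
  have hxk : x ^ k = 1 ∨ x ^ k = x := by
    obtain ⟨j, hj | hj⟩ := Int.even_or_odd' k
    · left; rw [hj, zpow_mul, zpow_ofNat, hw₀sq, one_zpow]
    · right; rw [hj, zpow_add, zpow_mul, zpow_ofNat, hw₀sq, one_zpow, one_mul, zpow_one]
  -- `y² = 1`, hence `y = 1`
  have hy2 : y ^ 2 = 1 := by
    rcases hxk with h | h
    · rw [h, one_mul] at hcg; rw [← hcg]; exact hsq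
    · rw [h] at hcg
      have : c ^ 2 = x ^ 2 * y ^ 2 := by rw [hcg, mul_pow]
      rw [hsq, hw₀sq, one_mul] at this
      exact this.symm
  have hy1 : y = 1 := by
    have hdvd : orderOf y ∣ 2 := orderOf_dvd_of_pow_eq_one hy2
    rcases (Nat.dvd_prime Nat.prime_two).mp hdvd with h | h
    · exact orderOf_eq_one_iff.mp h
    · exfalso; rw [h] at hyodd; exact (Nat.not_even_iff_odd.mpr hyodd) even_two
  rw [hy1, mul_one] at hcg
  rcases hxk with h | h
  · left; rw [hcg, h]
  · right; rw [hcg, h]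

end Kernel

end CMLayer

end Literature.NumberTheory.NumberFields

end
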